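import Literature.AnabelianGeometry.SemiGraphs.TemperedCoveringsComponents
import HarnessLib

/-!
# Restriction of a covering to a union of components; connected ⇒ one component ([SemiAnbd] §3 p. 37)

Sequel to `TemperedCoveringsComponents.lean`.  For an object `S` of `B^cov(𝒢)` and a set `A` of
points of `S` closed under adjacency (a union of connected components of the covering `𝒢' → 𝒢`,
[SemiAnbd] Def. 3.5 (ii) p. 37), the *restriction* `S|_A` (`CovObj.restrict`) is the sub-covering
on the points of `A`; it is tempered when `S` is, and `S` is the coproduct `S|_A ⊔ S|_{Aᶜ}` in
`B^cov(𝒢)` and in `B^temp(𝒢)` (`isColimitRestrictCofan`).  Consequently a connected object of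
`B^temp(𝒢)` in the categorical sense of the §0 dictionary has exactly one connected component
(`sameComponent_of_isConnectedObj`), complementing `isConnectedObj_of_sameComponent`.
-/

namespace Literature.AnabelianGeometry.SemiGraphs

namespace ProfiniteSemiGraph

open CategoryTheory CategoryTheory.Limits
open Literature.AlgebraicGeometry.Frobenioids (IsConnectedObj IsNonemptyObj)
open Literature.AlgebraicGeometry.Frobenioids.QuasiTemperoid.BTempConnected (ρ_one_apply
  ρ_mul_apply ρ_inv_apply)

universe u

variable {𝒢 : ProfiniteSemiGraph.{u}} (S : CovObj 𝒢) (A : S.Point → Prop)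
  (hA : ∀ p q, S.Adj p q → (A p ↔ A q))

/-! ### The restriction to a set of points closed under adjacency -/

/-- The vertex fibre of the restriction: the points of `S_v` lying in `A`, with the restricted
action. [cite: MochizukiSemiAnbd2006, Def 3.5(ii) p.37] -/
def CovObj.restrictVAction (v : 𝒢.graph.Vertex) : Action (Type u) (𝒢.Gv v) where
  V := {x : (S.SV v).obj.V // A (Sum.inl ⟨v, x⟩)}
  ρ :=
    { toFun := fun g => TypeCat.ofHom fun x =>
        ⟨(S.SV v).obj.ρ g x.1, (hA _ _ (CovObj.Adj.vertex v g x.1)).mp x.2⟩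
      map_one' := by
        apply ConcreteCategory.hom_ext
        intro x
        exact Subtype.ext (ρ_one_apply _ x.1)
      map_mul' := fun g g' => by
        apply ConcreteCategory.hom_ext
        intro x
        exact Subtype.ext (ρ_mul_apply _ g g' x.1) }

/-- The edge fibre of the restriction. [cite: MochizukiSemiAnbd2006, Def 3.5(ii) p.37] -/
def CovObj.restrictEAction (e : 𝒢.graph.Edge) : Action (Type u) (𝒢.Ge e) where
  V := {y : (S.SE e).obj.V // A (Sum.inr ⟨e, y⟩)}
  ρ :=
    { toFun := fun g => TypeCat.ofHom fun y =>
        ⟨(S.SE e).obj.ρ g y.1, (hA _ _ (CovObj.Adj.edge e g y.1)).mp y.2⟩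
      map_one' := by
        apply ConcreteCategory.hom_ext
        intro y
        exact Subtype.ext (ρ_one_apply _ y.1)
      map_mul' := fun g g' => by
        apply ConcreteCategory.hom_ext
        intro y
        exact Subtype.ext (ρ_mul_apply _ g g' y.1) }

/-- The restricted vertex fibre is an object of `B^temp(Π_v)` (countable, open stabilisers).
[cite: MochizukiSemiAnbd2006, Def 3.5(ii) p.37] -/
theorem CovObj.restrictVAction_mem (v : 𝒢.graph.Vertex) :
    temperedAction (𝒢.Gv v) (S.restrictVAction A hA v) := by
  haveI : Countable (S.SV v).obj.V := (S.SV v).property.1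
  refine ⟨inferInstanceAs (Countable {x : (S.SV v).obj.V // A (Sum.inl ⟨v, x⟩)}), fun x => ?_⟩
  have e : {g : 𝒢.Gv v | (S.restrictVAction A hA v).ρ g x = x} =
      {g : 𝒢.Gv v | (S.SV v).obj.ρ g x.1 = x.1} :=
    Set.ext fun g => ⟨fun h => congrArg Subtype.val h, fun h => Subtype.ext h⟩
  rw [e]
  exact (S.SV v).property.2 x.1

/-- The restricted edge fibre is an object of `B^temp(Π_e)`. [cite: MochizukiSemiAnbd2006, Def 3.5(ii) p.37] -/
theorem CovObj.restrictEAction_mem (e : 𝒢.graph.Edge) :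
    temperedAction (𝒢.Ge e) (S.restrictEAction A hA e) := by
  haveI : Countable (S.SE e).obj.V := (S.SE e).property.1
  refine ⟨inferInstanceAs (Countable {y : (S.SE e).obj.V // A (Sum.inr ⟨e, y⟩)}), fun y => ?_⟩
  have h : {g : 𝒢.Ge e | (S.restrictEAction A hA e).ρ g y = y} =
      {g : 𝒢.Ge e | (S.SE e).obj.ρ g y.1 = y.1} :=
    Set.ext fun g => ⟨fun h => congrArg Subtype.val h, fun h => Subtype.ext h⟩
  rw [h]
  exact (S.SE e).property.2 y.1

/-- The gluing of the restriction along `b : e → v`: `glue_b` preserves membership in `A`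
(adjacency `glue`). [cite: MochizukiSemiAnbd2006, Def 3.5(ii) p.37] -/
noncomputable def CovObj.restrictGlueEquiv (b : 𝒢.graph.Branch) (v : 𝒢.graph.Vertex)
    (h : 𝒢.graph.abuts b = some v) :
    {y : (S.SE (𝒢.graph.edgeOf b)).obj.V // A (Sum.inr ⟨_, y⟩)} ≃
      {x : (S.SV v).obj.V // A (Sum.inl ⟨v, x⟩)} where
  toFun y := ⟨(S.glue b v h).hom.hom.hom y.1, (hA _ _ (CovObj.Adj.glue b v h y.1)).mp y.2⟩
  invFun x := ⟨(S.glue b v h).inv.hom.hom x.1, by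
    have := (hA _ _ (CovObj.Adj.glue b v h ((S.glue b v h).inv.hom.hom x.1))).mpr
    rw [CovObj.glue_hom_inv] at this
    exact this x.2⟩
  left_inv y := Subtype.ext (S.glue_inv_hom b v h y.1)
  right_inv x := Subtype.ext (S.glue_hom_inv b v h x.1)

/-- **The restriction `S|_A`** of a covering to a set of points closed under adjacency (a union of
connected components). [cite: MochizukiSemiAnbd2006, Def 3.5(ii) p.37] -/
noncomputable def CovObj.restrict : CovObj 𝒢 where
  SV v := ⟨S.restrictVAction A hA v, S.restrictVAction_mem A hA v⟩
  SE e := ⟨S.restrictEAction A hA e, S.restrictEAction_mem A hA e⟩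
  glue b v h := BTemp.isoOfEquiv (S.restrictGlueEquiv A hA b v h) fun g y =>
    Subtype.ext (S.glue_ρ b v h g y.1)

/-- The inclusion `S|_A ⟶ S`. [cite: MochizukiSemiAnbd2006, Def 3.5(ii) p.37] -/
noncomputable def CovObj.restrictι : S.restrict A hA ⟶ S where
  fV v := ObjectProperty.homMk
    { hom := TypeCat.ofHom fun x : {x : (S.SV v).obj.V // A (Sum.inl ⟨v, x⟩)} => x.1
      comm := fun _ => rfl }
  fE e := ObjectProperty.homMk
    { hom := TypeCat.ofHom fun y : {y : (S.SE e).obj.V // A (Sum.inr ⟨e, y⟩)} => y.1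
      comm := fun _ => rfl }
  comm b v h := by
    apply ObjectProperty.hom_ext
    apply Action.Hom.ext
    apply ConcreteCategory.hom_ext
    intro y
    rfl

/-- The underlying point of a point of the restriction is its image under the inclusion.
[cite: MochizukiSemiAnbd2006, Def 3.5(ii) p.37] -/
theorem CovObj.mapPoint_restrictι_mem (p : (S.restrict A hA).Point) :
    A (CovHom.mapPoint (S.restrictι A hA) p) := by
  rcases p with ⟨v, x⟩ | ⟨e, y⟩
  · exact x.2
  · exact y.2

/-- **The restriction of a tempered covering is tempered** (the same finite covering splits it).
[cite: MochizukiSemiAnbd2006, Def 3.5(ii) p.37] -/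
theorem CovObj.restrict_isTempered (hS : S.IsTempered) : (S.restrict A hA).IsTempered := by
  intro p
  obtain ⟨F, hF, hN, hsplit⟩ := hS (CovHom.mapPoint (S.restrictι A hA) p)
  refine ⟨F, hF, hN, fun q hq => ?_⟩
  have hq' := hsplit _ (CovHom.mapPoint_sameComponent (S.restrictι A hA) hq)
  rcases q with ⟨v, x⟩ | ⟨e, y⟩
  · intro z g hg
    exact Subtype.ext (hq' z g hg)
  · intro z g hg
    exact Subtype.ext (hq' z g hg)

/-! ### `S = S|_A ⊔ S|_{Aᶜ}` -/

include hA in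
/-- The complement of a set of points closed under adjacency is closed under adjacency.
[cite: MochizukiSemiAnbd2006, Def 3.5(ii) p.37] -/
theorem CovObj.compl_closed : ∀ p q, S.Adj p q → (¬ A p ↔ ¬ A q) :=
  fun p q h => not_congr (hA p q h)

open Classical in
/-- The morphism `S ⟶ T` obtained by gluing morphisms on `S|_A` and `S|_{Aᶜ}`.
[cite: MochizukiSemiAnbd2006, Def 3.5(ii) p.37] -/
noncomputable def CovObj.restrictDesc {T : CovObj 𝒢} (f : S.restrict A hA ⟶ T)
    (g : S.restrict (fun p => ¬ A p) (S.compl_closed A hA) ⟶ T) : S ⟶ T where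
  fV v := ObjectProperty.homMk
    { hom := TypeCat.ofHom fun x => if h : A (Sum.inl ⟨v, x⟩) then (f.fV v).hom.hom ⟨x, h⟩
        else (g.fV v).hom.hom ⟨x, h⟩
      comm := fun k => by
        apply ConcreteCategory.hom_ext
        intro x
        change (if h : A (Sum.inl ⟨v, (S.SV v).obj.ρ k x⟩) then _ else _) =
          (T.SV v).obj.ρ k (if h : A (Sum.inl ⟨v, x⟩) then _ else _)
        by_cases hx : A (Sum.inl ⟨v, x⟩)
        · have hx' : A (Sum.inl ⟨v, (S.SV v).obj.ρ k x⟩) := (hA _ _ (CovObj.Adj.vertex v k x)).mp hx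
          rw [dif_pos hx', dif_pos hx]
          exact CovHom.fV_ρ_apply f v k ⟨x, hx⟩
        · have hx' : ¬ A (Sum.inl ⟨v, (S.SV v).obj.ρ k x⟩) :=
            fun h' => hx ((hA _ _ (CovObj.Adj.vertex v k x)).mpr h')
          rw [dif_neg hx', dif_neg hx]
          exact CovHom.fV_ρ_apply g v k ⟨x, hx⟩ }
  fE e := ObjectProperty.homMk
    { hom := TypeCat.ofHom fun y => if h : A (Sum.inr ⟨e, y⟩) then (f.fE e).hom.hom ⟨y, h⟩
        else (g.fE e).hom.hom ⟨y, h⟩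
      comm := fun k => by
        apply ConcreteCategory.hom_ext
        intro y
        change (if h : A (Sum.inr ⟨e, (S.SE e).obj.ρ k y⟩) then _ else _) =
          (T.SE e).obj.ρ k (if h : A (Sum.inr ⟨e, y⟩) then _ else _)
        by_cases hy : A (Sum.inr ⟨e, y⟩)
        · have hy' : A (Sum.inr ⟨e, (S.SE e).obj.ρ k y⟩) := (hA _ _ (CovObj.Adj.edge e k y)).mp hy
          rw [dif_pos hy', dif_pos hy]
          exact CovHom.fE_ρ_apply f e k ⟨y, hy⟩
        · have hy' : ¬ A (Sum.inr ⟨e, (S.SE e).obj.ρ k y⟩) :=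
            fun h' => hy ((hA _ _ (CovObj.Adj.edge e k y)).mpr h')
          rw [dif_neg hy', dif_neg hy]
          exact CovHom.fE_ρ_apply g e k ⟨y, hy⟩ }
  comm b v h := by
    apply ObjectProperty.hom_ext
    apply Action.Hom.ext
    apply ConcreteCategory.hom_ext
    intro y
    change (T.glue b v h).hom.hom.hom (if hy : A (Sum.inr ⟨_, y⟩) then (f.fE _).hom.hom ⟨y, hy⟩
        else (g.fE _).hom.hom ⟨y, hy⟩) =
      if hx : A (Sum.inl ⟨v, (S.glue b v h).hom.hom.hom y⟩) then
        (f.fV v).hom.hom ⟨(S.glue b v h).hom.hom.hom y, hx⟩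
      else (g.fV v).hom.hom ⟨(S.glue b v h).hom.hom.hom y, hx⟩
    by_cases hy : A (Sum.inr ⟨_, y⟩)
    · have hx : A (Sum.inl ⟨v, (S.glue b v h).hom.hom.hom y⟩) :=
        (hA _ _ (CovObj.Adj.glue b v h y)).mp hy
      rw [dif_pos hy, dif_pos hx]
      exact (CovHom.fV_glue_apply f b v h ⟨y, hy⟩).symm
    · have hx : ¬ A (Sum.inl ⟨v, (S.glue b v h).hom.hom.hom y⟩) :=
        fun h' => hy ((hA _ _ (CovObj.Adj.glue b v h y)).mpr h')
      rw [dif_neg hy, dif_neg hx]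
      exact (CovHom.fV_glue_apply g b v h ⟨y, hy⟩).symm

open Classical in
/-- **`S` is the coproduct of `S|_A` and `S|_{Aᶜ}` in `B^cov(𝒢)`.**
[cite: MochizukiSemiAnbd2006, Def 3.5(ii) p.37] -/
noncomputable def CovObj.isColimitRestrictCofan :
    IsColimit (BinaryCofan.mk (S.restrictι A hA)
      (S.restrictι (fun p => ¬ A p) (S.compl_closed A hA))) :=
  BinaryCofan.IsColimit.mk _ (fun f g => S.restrictDesc A hA f g)
    (fun f g => by
      refine CovHom.ext (funext fun v => ?_) (funext fun e => ?_)
      · apply ObjectProperty.hom_ext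
        apply Action.Hom.ext
        apply ConcreteCategory.hom_ext
        intro x
        exact dif_pos x.2
      · apply ObjectProperty.hom_ext
        apply Action.Hom.ext
        apply ConcreteCategory.hom_ext
        intro y
        exact dif_pos y.2)
    (fun f g => by
      refine CovHom.ext (funext fun v => ?_) (funext fun e => ?_)
      · apply ObjectProperty.hom_ext
        apply Action.Hom.ext
        apply ConcreteCategory.hom_ext
        intro x
        exact dif_neg x.2
      · apply ObjectProperty.hom_ext
        apply Action.Hom.ext
        apply ConcreteCategory.hom_ext
        intro y
        exact dif_neg y.2)
    (fun f g m hf hg => by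
      subst hf
      subst hg
      refine CovHom.ext (funext fun v => ?_) (funext fun e => ?_)
      · apply ObjectProperty.hom_ext
        apply Action.Hom.ext
        apply ConcreteCategory.hom_ext
        intro x
        change (m.fV v).hom.hom x = if h : A (Sum.inl ⟨v, x⟩) then _ else _
        by_cases hx : A (Sum.inl ⟨v, x⟩)
        · rw [dif_pos hx]; rfl
        · rw [dif_neg hx]; rfl
      · apply ObjectProperty.hom_ext
        apply Action.Hom.ext
        apply ConcreteCategory.hom_ext
        intro y
        change (m.fE e).hom.hom y = if h : A (Sum.inr ⟨e, y⟩) then _ else _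
        by_cases hy : A (Sum.inr ⟨e, y⟩)
        · rw [dif_pos hy]; rfl
        · rw [dif_neg hy]; rfl)

/-- The restriction of an object of `B^temp(𝒢)`, as an object of `B^temp(𝒢)`.
[cite: MochizukiSemiAnbd2006, Def 3.5(ii) p.37] -/
noncomputable def restrictT (S : BTempCat 𝒢) (A : S.obj.Point → Prop)
    (hA : ∀ p q, S.obj.Adj p q → (A p ↔ A q)) : BTempCat 𝒢 :=
  ⟨S.obj.restrict A hA, S.obj.restrict_isTempered A hA S.property⟩

/-- **`S = S|_A ⊔ S|_{Aᶜ}` in `B^temp(𝒢)`.** [cite: MochizukiSemiAnbd2006, Def 3.5(ii) p.37] -/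
noncomputable def isColimitRestrictTCofan (S : BTempCat 𝒢) (A : S.obj.Point → Prop)
    (hA : ∀ p q, S.obj.Adj p q → (A p ↔ A q)) :
    IsColimit (BinaryCofan.mk
      (ObjectProperty.homMk (S.obj.restrictι A hA) : restrictT S A hA ⟶ S)
      (ObjectProperty.homMk (S.obj.restrictι (fun p => ¬ A p) (S.obj.compl_closed A hA)) :
        restrictT S (fun p => ¬ A p) (S.obj.compl_closed A hA) ⟶ S)) :=
  BinaryCofan.IsColimit.mk _
    (fun f g => ObjectProperty.homMk
      ((S.obj.isColimitRestrictCofan A hA).desc (BinaryCofan.mk f.hom g.hom)))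
    (fun f g => by
      apply ObjectProperty.hom_ext
      exact (S.obj.isColimitRestrictCofan A hA).fac (BinaryCofan.mk f.hom g.hom)
        ⟨WalkingPair.left⟩)
    (fun f g => by
      apply ObjectProperty.hom_ext
      exact (S.obj.isColimitRestrictCofan A hA).fac (BinaryCofan.mk f.hom g.hom)
        ⟨WalkingPair.right⟩)
    (fun f g m hf hg => by
      apply ObjectProperty.hom_ext
      refine BinaryCofan.IsColimit.hom_ext (S.obj.isColimitRestrictCofan A hA) ?_ ?_
      · exact (congrArg (·.hom) hf).trans
          ((S.obj.isColimitRestrictCofan A hA).fac (BinaryCofan.mk f.hom g.hom)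
            ⟨WalkingPair.left⟩).symm
      · exact (congrArg (·.hom) hg).trans
          ((S.obj.isColimitRestrictCofan A hA).fac (BinaryCofan.mk f.hom g.hom)
            ⟨WalkingPair.right⟩).symm)

/-! ### Connected objects have one component -/

/-- The connected component of a point is closed under adjacency.
[cite: MochizukiSemiAnbd2006, Def 3.5(ii) p.37] -/
theorem CovObj.sameComponent_closed (p : S.Point) :
    ∀ q q', S.Adj q q' → (S.SameComponent p q ↔ S.SameComponent p q') := fun _ _ h =>
  ⟨fun hq => hq.trans _ _ _ (Relation.EqvGen.rel _ _ h),
    fun hq' => hq'.trans _ _ _ (Relation.EqvGen.symm _ _ (Relation.EqvGen.rel _ _ h))⟩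

/-- A point of `S` lying in `A`, as a point of `S|_A`. [cite: MochizukiSemiAnbd2006, Def 3.5(ii) p.37] -/
def CovObj.restrictPoint : ∀ p : S.Point, A p → (S.restrict A hA).Point
  | Sum.inl ⟨v, x⟩, hp => Sum.inl ⟨v, ⟨x, hp⟩⟩
  | Sum.inr ⟨e, y⟩, hp => Sum.inr ⟨e, ⟨y, hp⟩⟩

/-- **A connected object of `B^temp(𝒢)` (in the categorical sense) has a single connected
component**: otherwise `S = S|_A ⊔ S|_{Aᶜ}` for `A` the component of a point, with both summands
non-initial. [cite: MochizukiSemiAnbd2006, Def 3.5(iii) p.37] -/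
theorem sameComponent_of_isConnectedObj (S : BTempCat 𝒢) (hS : IsConnectedObj S)
    (p q : S.obj.Point) : S.obj.SameComponent p q := by
  by_contra hpq
  have hA := S.obj.sameComponent_closed p
  have h₁ : IsNonemptyObj (restrictT S _ hA) :=
    isNonemptyObj_of_point _ (S.obj.restrictPoint _ hA p (Relation.EqvGen.refl p))
  have h₂ : IsNonemptyObj (restrictT S (fun r => ¬ S.obj.SameComponent p r)
      (S.obj.compl_closed _ hA)) :=
    isNonemptyObj_of_point _ (S.obj.restrictPoint _ (S.obj.compl_closed _ hA) q hpq)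
  exact (hS.2 _ _ _ _ h₁ h₂).false (isColimitRestrictTCofan S _ hA)

end ProfiniteSemiGraph

end Literature.AnabelianGeometry.SemiGraphs
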